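import Literature.NumberTheory.Automorphic.CaraianiNewtonResidualImageModularity
import Literature.NumberTheory.GaloisRepresentations.DecomposedGenericOfQuadratic
import HarnessLib

/-!
# Caraiani–Newton, Cor. 6.1.1 (non-CM, as printed): proofs file — the corollary is Theorem 6.1 away

Sibling proofs file of `Literature.NumberTheory.Automorphic.CaraianiNewtonResidualImageModularity`
(named facts `CaraianiNewton2023_cor611_modular`, `CaraianiNewton2023_cor611_nonCM_printed`:
A. Caraiani, J. Newton, *On the modularity of elliptic curves over imaginary quadratic fields*,
arXiv:2301.10509v3 [CaraianiNewton2023], Cor. 6.1.1, p. 87), kept separate so that the fact file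
does not inherit the analytic import closure of Chebotarev's theorem.

The printed proof of Cor. 6.1.1 is one line: *"Combine Theorem 6.1 and Lemma 6.2.2."*  The fact
file records it as the reduction
`CaraianiNewton2023_cor611_nonCM_printed_of_thm61_of_lemma622` with BOTH ingredients as hypotheses.
Lemma 6.2.2 is now a theorem of the tree —
`Literature.NumberTheory.GaloisRepresentations.isDecomposedGeneric_of_isAbsolutelyIrreducible_restrictField_cyclotomic`
(`GaloisRepresentations/DecomposedGenericOfQuadratic`: Goursat/Dickson group theory from
`CartanNormalizerCriterionGaloisImage`, Chebotarev from the proved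
`Literature.NumberTheory.Automorphic.chebotarev_artinRep_holds`) — so here:

* `CaraianiNewton2023_lemma622` — Lemma 6.2.2 in exactly the shape of hypothesis (L) of the
  reduction (a restatement of the proved theorem, for the record);
* `CaraianiNewton2023_cor611_nonCM_printed_of_thm61` — **the named fact follows from Theorem 6.1
  alone** (hypothesis (A) of the reduction: Thm. 6.1 for non-CM curves over imaginary CM fields
  `F ∌ ζ₅`, "modular" read through Lemma 6.1.3, in the tree's vocabulary `NumberField.IsCMField`,
  `IsDecomposedGeneric`, `ModPImageAbsIrreducibleOverCyclotomic`, `CuspidalAutomorphicRepData`);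
* `CaraianiNewton2023_cor611_modular_of_thm61` — likewise for the narrow companion fact, granted in
  addition the classical small mod-`3` image of CM curves.

Of the printed proof of Theorem 6.1 itself (p. 90: Props. 6.1.5 / 6.1.6, Lemmas 6.1.3 / 6.1.4 /
6.1.7, Thm. 5.2, solvable descent) the one ingredient that is pure Galois theory is proved here too:

* `CaraianiNewton2023_lemma614` (`…_of_det` for a bare `ρ̄` with `det ρ̄ = χ̄₅`) — **Lemma 6.1.4**
  (p. 88): if `ζ₅ ∉ F` and the projective image of `ρ̄_{E,5}(G_{F(ζ₅)})` is `PSL₂(𝔽₅)`, the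
  extension of `F` cut out by the projective image of `ρ̄_{E,5}` does not contain `ζ₅` — this is
  hypothesis (4) of the automorphy lifting Theorem 5.2 (p. 73) for `ρ = r_{E,5}^∨`; with the
  supporting `mem_absGaloisGroupAdjoinRootsOfUnity_iff_modPCyclotomicCharacterZMod_eq_one`
  (`Γ_{K(ζ_p)} = ker χ̄_p`) and `exists_modPCyclotomicCharacterZMod_ne_one` (`ζ_p ∉ K ⟹ χ̄_p ≠ 1`).

What remains between the tree and `CaraianiNewton2023_cor611_nonCM_printed_holds` is therefore
exactly Theorem 6.1 of the source, i.e. the automorphy lifting Theorem 5.2 (Taylor–Wiles–Kisin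
patching on `P`-ordinary completed cohomology, §§2–5) combined with the residual modularity
propositions of [AKT23] and solvable descent — none of which has a carrier in Mathlib or
`Literature` (see the "Status" sections of the fact file); no new named fact is introduced (D-0026:
the gate refuses a named fact for Thm. 6.1 itself from a discharge seat, `lint.fact-fanout`; a
compiled draft `CaraianiNewton2023_thm61_nonCM`, with the corollary facts hanging off it by the
theorems of this file, is recorded in that seat's notes for a planner).  Among the named facts that
DO exist in the tree, the printed proof rests on
`Literature.NumberTheory.Automorphic.Scholze2015_galoisRep_of_modPEigensystem` ([Sch15, Cor. V.4.3],
file `Automorphic/ScholzeTorsionGalois`, undischarged): the Galois determinants attached to torsion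
classes in completed cohomology on which §§2–5 and Thm. 5.2 are built enter through Thm. 2.1.20 of
the source (p. 22: *"This is [ACC⁺18, Theorem 2.3.5]: it essentially follows from [Sch15,
Corollary 5.4.3]"*) — a necessary, by no means sufficient, prerequisite of any discharge, on which
the discharge of `CaraianiNewton2023_cor611_nonCM_printed` is parked.

## References

* [CaraianiNewton2023] A. Caraiani, J. Newton, arXiv:2301.10509v3: Cor. 6.1.1 and its proof
  (p. 87), Thm. 6.1 (p. 87; proof p. 90), Lemma 6.1.3 and Lemma 6.1.4 (p. 88), Thm. 5.2 (4)
  (p. 73), Thm. 2.1.20 (p. 22), Def. 2.1.27 (p. 25), Lemma 6.2.2 (pp. 90–91).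
* [Scholze2015] P. Scholze, *On torsion in the cohomology of locally symmetric varieties*, Ann. of
  Math. 182 (2015), Cor. V.4.3 — through the tree's `Scholze2015_galoisRep_of_modPEigensystem`.
-/

namespace Literature.NumberTheory.Automorphic

open Literature.NumberTheory.GaloisRepresentations
open _root_.NumberField IsDedekindDomain Polynomial Field
open scoped _root_.NumberField MatrixGroups

/-- **Caraiani–Newton (2023), Lemma 6.2.2, in the shape of hypothesis (L) of
`CaraianiNewton2023_cor611_nonCM_printed_of_thm61_of_lemma622`** (a restatement of the proved
`isDecomposedGeneric_of_isAbsolutelyIrreducible_restrictField_cyclotomic`): for `F/ℚ` quadratic,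
`p` an odd prime and `ρ̄ : Γ_F →ₜ* GL₂(𝔽_p)` continuous with `ρ̄|_{Γ_L}` absolutely irreducible for
every model `L` of `F(ζ_p)`, `ρ̄` is decomposed generic.
[cite: CaraianiNewton2023, Lemma 6.2.2 (p. 90; proof pp. 90–91)] -/
theorem CaraianiNewton2023_lemma622 :
    ∀ (F : Type) [Field F] [NumberField F], Module.finrank ℚ F = 2 →
      ∀ (p : ℕ) [Fact p.Prime], p ≠ 2 → ∀ ρ : ModPGaloisRep F (ZMod p) 2,
        (∀ (L : Type) [Field L] [Algebra F L] [IsCyclotomicExtension {p} F L],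
          FramedRep.IsAbsolutelyIrreducible (FramedGaloisRep.restrictField L ρ)) →
        IsDecomposedGeneric (ρ : absoluteGaloisGroup F →* GL (Fin 2) (ZMod p)) :=
  fun F _ _ hF2 p _ hp2 ρ h ↦
    isDecomposedGeneric_of_isAbsolutelyIrreducible_restrictField_cyclotomic F hF2 p hp2 ρ h

/-- **Cor. 6.1.1 (non-CM, as printed) follows from Theorem 6.1 alone.**  Granted
(A) = Caraiani–Newton, Thm. 6.1 (p. 87) for curves without CM, "modular" read through Lemma 6.1.3
(p. 88) — rendered exactly as hypothesis `hA` of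
`CaraianiNewton2023_cor611_nonCM_printed_of_thm61_of_lemma622`: `F` a number field with
`NumberField.IsCMField F` in which every fifth root of unity is `1`, `E / F` elliptic with
`¬ E.HasCM`, `p ∈ {3, 5}`, every framing of `E[p]` decomposed generic (`IsDecomposedGeneric`,
[ACC⁺23, Def. 4.3.1]; the source's Definition 2.1.27, p. 25, is slightly weaker — it omits
`α_i ≠ α_j` — so (A) asks slightly more of `E` and is implied by the printed theorem) and
`ModPImageAbsIrreducibleOverCyclotomic E p` ⟹ a weight-zero cuspidal `π` of `GL₂(𝔸_F)` with Hecke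
polynomial `X² − a_w X + q_w` at every place `w` of good reduction — the named fact
`CaraianiNewton2023_cor611_nonCM_printed` holds: the reduction
`CaraianiNewton2023_cor611_nonCM_printed_of_thm61_of_lemma622` with its hypothesis (L) discharged
by the proved Lemma 6.2.2 (`CaraianiNewton2023_lemma622`).  (A) has no carrier in the tree
(automorphy lifting, [AKT23], solvable descent) and stays a hypothesis; this is a reduction of the
fact to the printed Theorem 6.1, not a discharge.
[cite: CaraianiNewton2023, Cor. 6.1.1 p. 87 (proof: "Combine Theorem 6.1 and Lemma 6.2.2"), Thm. 6.1 p. 87, Lemma 6.1.3 p. 88] -/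
theorem CaraianiNewton2023_cor611_nonCM_printed_of_thm61
    (hA : ∀ (F : Type) [Field F] [NumberField F], NumberField.IsCMField F →
      (∀ x : F, x ^ 5 = 1 → x = 1) → ∀ (E : WeierstrassCurve F) [E.IsElliptic], ¬ E.HasCM →
        ∀ (p : ℕ) [Fact p.Prime], (p = 3 ∨ p = 5) →
          (∀ ρ : ModPGaloisRep F (ZMod p) 2, E.IsTorsionGaloisRep p ρ →
            IsDecomposedGeneric (ρ : absoluteGaloisGroup F →* GL (Fin 2) (ZMod p))) →
          ModPImageAbsIrreducibleOverCyclotomic E p →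
            ∃ (hF : isCompact_glFiniteIntegralLevel 2 F) (π : CuspidalAutomorphicRepData 2 F hF),
              π.1.HasWeightZero ∧
                ∀ w : HeightOneSpectrum (𝓞 F), E.HasGoodReductionAt w →
                  π.1.HasHeckePolynomialAt w
                    ((frobPoly (E.frobeniusTraceAt w) w.residueCard).map (Int.castRingHom ℂ))) :
    CaraianiNewton2023_cor611_nonCM_printed :=
  CaraianiNewton2023_cor611_nonCM_printed_of_thm61_of_lemma622 hA CaraianiNewton2023_lemma622

/-- **The narrow fact, too, is Theorem 6.1 away — granted the small mod-`3` image of CM curves.**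
`CaraianiNewton2023_cor611_modular` (hypothesis `SL₂(𝔽₃) ⊆ im ρ̄_{E,3}`) from (A) = Thm. 6.1 as
above and (B) = the classical fact that for a CM curve no framing of `E[3]` has image containing
`SL₂(𝔽₃)` (hypothesis (B) of `CaraianiNewton2023_cor611_modular_of_cor611_nonCM`, no carrier in the
tree), through `CaraianiNewton2023_cor611_nonCM_printed.cor611_modular`.
[cite: CaraianiNewton2023, Cor. 6.1.1 (1) p. 87, Thm. 6.1 p. 87] -/
theorem CaraianiNewton2023_cor611_modular_of_thm61
    (hA : ∀ (F : Type) [Field F] [NumberField F], NumberField.IsCMField F →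
      (∀ x : F, x ^ 5 = 1 → x = 1) → ∀ (E : WeierstrassCurve F) [E.IsElliptic], ¬ E.HasCM →
        ∀ (p : ℕ) [Fact p.Prime], (p = 3 ∨ p = 5) →
          (∀ ρ : ModPGaloisRep F (ZMod p) 2, E.IsTorsionGaloisRep p ρ →
            IsDecomposedGeneric (ρ : absoluteGaloisGroup F →* GL (Fin 2) (ZMod p))) →
          ModPImageAbsIrreducibleOverCyclotomic E p →
            ∃ (hF : isCompact_glFiniteIntegralLevel 2 F) (π : CuspidalAutomorphicRepData 2 F hF),
              π.1.HasWeightZero ∧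
                ∀ w : HeightOneSpectrum (𝓞 F), E.HasGoodReductionAt w →
                  π.1.HasHeckePolynomialAt w
                    ((frobPoly (E.frobeniusTraceAt w) w.residueCard).map (Int.castRingHom ℂ)))
    (hB : ∀ (F : Type) [Field F] [NumberField F] (E : WeierstrassCurve F) [E.IsElliptic],
      E.HasCM → ¬ ∃ ρ₃ : FramedGaloisRep F (ZMod 3) 2, E.IsTorsionGaloisRep 3 ρ₃ ∧
        ∀ g : Matrix.SpecialLinearGroup (Fin 2) (ZMod 3), ∃ σ,
          ρ₃ σ = Matrix.SpecialLinearGroup.toGL g) :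
    CaraianiNewton2023_cor611_modular :=
  (CaraianiNewton2023_cor611_nonCM_printed_of_thm61 hA).cor611_modular hB

/-! ### Lemma 6.1.4: the projective kernel of `ρ̄_{E,5}` moves `ζ₅` -/

section Lemma614

variable {K : Type*} [Field K] [CharZero K] {p : ℕ} [Fact p.Prime]

/-- **`Γ_{K(ζ_p)} = ker χ̄_p`.**  An element `σ ∈ Γ_K` lies in `Γ_{K(μ_p)}`
(`absGaloisGroupAdjoinRootsOfUnity K p`: `σ` fixes every `p`-th root of unity of `K̄`,
`mem_absGaloisGroupAdjoinRootsOfUnity_iff`) iff the mod-`p` cyclotomic character is trivial on it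
(`modPCyclotomicCharacterZMod_spec`: `σ ζ = ζ ^ {χ̄_p(σ)}`; uniqueness
`modularCyclotomicCharacter.unique`). [folklore] -/
theorem _root_.Literature.NumberTheory.GaloisRepresentations.mem_absGaloisGroupAdjoinRootsOfUnity_iff_modPCyclotomicCharacterZMod_eq_one
    (σ : absoluteGaloisGroup K) :
    σ ∈ absGaloisGroupAdjoinRootsOfUnity K p ↔ modPCyclotomicCharacterZMod K p σ = 1 := by
  rw [mem_absGaloisGroupAdjoinRootsOfUnity_iff]
  constructor
  · intro h
    ext
    rw [Units.val_one]
    refine (modularCyclotomicCharacter.unique (AlgebraicClosure K)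
      (HasEnoughRootsOfUnity.natCard_rootsOfUnity (AlgebraicClosure K) p) _ fun t ht => ?_).symm
    rw [ZMod.val_one, pow_one]
    have ht' : ((t : (AlgebraicClosure K)ˣ) : AlgebraicClosure K) ^ p = 1 := by
      rw [← Units.val_pow_eq_pow_val, (mem_rootsOfUnity p t).1 ht, Units.val_one]
    exact h _ ht'
  · intro h x hx
    rw [modPCyclotomicCharacterZMod_spec K p σ x hx, h, Units.val_one,
      ZMod.val_one'' (Fact.out : p.Prime).one_lt.ne', pow_one]

/-- **`ζ_p ∉ K ⟹ χ̄_p` is non-trivial on `Γ_K`** (`char K = 0`).  If every `p`-th root of unity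
of `K` is `1`, some `σ ∈ Γ_K` has `χ̄_p(σ) ≠ 1`: otherwise a primitive `p`-th root of unity
`ζ ∈ K̄` (`HasEnoughRootsOfUnity.exists_primitiveRoot`) is fixed by all of `Gal(K̄/K)`, hence lies
in `K` (`InfiniteGalois.mem_range_algebraMap_iff_fixed`; `K̄/K` is Galois in characteristic `0`),
hence equals `1`, contradicting `p > 1`.  The hypothesis "`ζ₅ ∉ F`" of Caraiani–Newton Thm. 6.1 /
Lemma 6.1.4 enters only through this. [folklore] -/
theorem _root_.Literature.NumberTheory.GaloisRepresentations.exists_modPCyclotomicCharacterZMod_ne_one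
    (hK : ∀ x : K, x ^ p = 1 → x = 1) :
    ∃ σ : absoluteGaloisGroup K, modPCyclotomicCharacterZMod K p σ ≠ 1 := by
  by_contra! hall
  obtain ⟨ζ, hζ⟩ := HasEnoughRootsOfUnity.exists_primitiveRoot (AlgebraicClosure K) p
  have hfix : ∀ σ : absoluteGaloisGroup K, σ • ζ = ζ := fun σ ↦
    (mem_absGaloisGroupAdjoinRootsOfUnity_iff σ).1
      ((mem_absGaloisGroupAdjoinRootsOfUnity_iff_modPCyclotomicCharacterZMod_eq_one σ).2
        (hall σ)) ζ hζ.pow_eq_one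
  haveI : IsGalois K (AlgebraicClosure K) := IsGalois.mk
  obtain ⟨x, hx⟩ := (InfiniteGalois.mem_range_algebraMap_iff_fixed ζ).2 fun f ↦ hfix f
  have hxp : x ^ p = 1 := by
    apply (algebraMap K (AlgebraicClosure K)).injective
    rw [map_pow, hx, hζ.pow_eq_one, map_one]
  have hx1 := hK x hxp
  subst hx1
  rw [map_one] at hx
  exact hζ.ne_one (Fact.out : p.Prime).one_lt hx.symm

end Lemma614

/-- In `(ℤ/5ℤ)ˣ ≅ C₄` every element `≠ 1` is `-1` or squares to `-1`. [folklore] -/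
private theorem units_zmod_five_eq_neg_one_or_sq_eq_neg_one (u : (ZMod 5)ˣ) (hu : u ≠ 1) :
    u = -1 ∨ u ^ 2 = -1 := by
  revert u; decide

/-- `-1 ≠ 1` in `(ℤ/5ℤ)ˣ`. [folklore] -/
private theorem neg_one_ne_one_units_zmod_five : (-1 : (ZMod 5)ˣ) ≠ 1 := by decide

/-- `3² · (-1) = 1` in `ℤ/5ℤ`: `det (3 g) = 1` when `det g = -1`. [folklore] -/
private theorem three_sq_mul_neg_one_zmod_five : (3 : ZMod 5) ^ 2 * -1 = 1 := by decide

/-- **Caraiani–Newton (2023), Lemma 6.1.4, for a bare `ρ̄ : Γ_K → GL₂(𝔽₅)` with cyclotomic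
determinant.**  Printed (p. 88): *"Lemma 6.1.4. Let `F` be a CM field with `ζ₅ ∉ F` and let `E/F`
be an elliptic curve such that the projective image of `r̄_{E,5}(G_{F(ζ₅)})` is conjugate to
`PSL₂(𝔽₅)`. Then the extension of `F` cut out by the projective image of `r̄_{E,5}(G_F)` does not
contain `ζ₅`."* — which is hypothesis (4) of the automorphy lifting Theorem 5.2 (p. 73: *"If
`p = 5` and the projective image of `ρ̄(G_{F(ζ₅)})` is conjugate to `PSL₂(𝔽₅)`, we assume further
that the extension of `F` cut out by the projective image of `ρ̄` does not contain `ζ₅`"*), used in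
the proof of Thm. 6.1 (p. 90: *"The assumption that `ζ₅ ∉ F` is sufficient to check the condition
on the projective image of `ρ̄` in the theorem, by Lemma 6.1.4"*).
Rendering, for any field `K` of characteristic `0` (the CM hypothesis is not used by the printed
proof) and any homomorphism `ρ̄ : Γ_K → GL₂(𝔽₅)` with `det ρ̄ = χ̄₅` (`hdet`; for `ρ̄ = ρ̄_{E,5}`
this is the Weil pairing, `CaraianiNewton2023_lemma614`): "`ζ₅ ∉ K`" is `hK` (every fifth root of
unity of `K` is `1`); `Γ_{K(ζ₅)}` is `absGaloisGroupAdjoinRootsOfUnity K 5`; since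
`det ρ̄ = χ̄₅` is trivial on `Γ_{K(ζ₅)}`, the projective image of `ρ̄(Γ_{K(ζ₅)})` lies in
`PSL₂(𝔽₅)`, and "is conjugate to (equivalently, equals) `PSL₂(𝔽₅)`" is `hPSL`: every matrix of
determinant `1` is, up to a scalar, a value of `ρ̄` on `Γ_{K(ζ₅)}`; the extension cut out by the
projective image of `ρ̄` is the fixed field of the projective kernel
`G = {σ | ρ̄(σ) scalar}`, and it contains `ζ₅` iff `G ≤ Γ_{K(ζ₅)}`, so the conclusion "does not
contain `ζ₅`" is: some `σ` with `ρ̄(σ)` scalar lies outside `Γ_{K(ζ₅)}`.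
Proof (the source's, p. 88, with its two cases merged): as `ζ₅ ∉ K`, `χ̄₅` is non-trivial
(`exists_modPCyclotomicCharacterZMod_ne_one`), so its image — a non-trivial subgroup of
`𝔽₅ˣ ≅ C₄`, of order `2` or `4` in the source's words — contains `-1`: there is `σ₁` with
`det ρ̄(σ₁) = χ̄₅(σ₁) = -1`.  Then `3 ρ̄(σ₁)` has determinant `9 · (-1) = 1`, so by `hPSL` there are
`τ ∈ Γ_{K(ζ₅)}` and a scalar `c` with `ρ̄(τ) = 3c · ρ̄(σ₁)`; hence `σ = σ₁ τ⁻¹` has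
`ρ̄(σ) = (3c)⁻¹` scalar while `χ̄₅(σ) = χ̄₅(σ₁) = -1 ≠ 1`, i.e. `σ ∉ Γ_{K(ζ₅)}`
(`mem_absGaloisGroupAdjoinRootsOfUnity_iff_modPCyclotomicCharacterZMod_eq_one`).  (The source
first upgrades the hypothesis to `ρ̄(G_{F(ζ₅)}) = SL₂(𝔽₅)` and distinguishes `|im χ̄₅| = 2`, where
the projective image of `ρ̄(G_F)` is again `PSL₂(𝔽₅)` and `[G : H] = [F(ζ₅) : F] > 1`, from
`|im χ̄₅| = 4 > [PGL₂(𝔽₅) : PSL₂(𝔽₅)]`; both cases only use an element of determinant `-1`.)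
[cite: CaraianiNewton2023, Lemma 6.1.4 p. 88; Thm. 5.2 (4) p. 73; proof of Thm. 6.1 p. 90] -/
theorem CaraianiNewton2023_lemma614_of_det {K : Type*} [Field K] [CharZero K]
    [Fact (Nat.Prime 5)] (hK : ∀ x : K, x ^ 5 = 1 → x = 1)
    (ρ : absoluteGaloisGroup K →* GL (Fin 2) (ZMod 5))
    (hdet : ∀ σ, Matrix.GeneralLinearGroup.det (ρ σ) = modPCyclotomicCharacterZMod K 5 σ)
    (hPSL : ∀ M : Matrix (Fin 2) (Fin 2) (ZMod 5), M.det = 1 →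
      ∃ τ ∈ absGaloisGroupAdjoinRootsOfUnity K 5, ∃ c : ZMod 5,
        ((ρ τ : GL (Fin 2) (ZMod 5)) : Matrix (Fin 2) (Fin 2) (ZMod 5)) = c • M) :
    ∃ σ : absoluteGaloisGroup K,
      (∃ c : ZMod 5, ((ρ σ : GL (Fin 2) (ZMod 5)) : Matrix (Fin 2) (Fin 2) (ZMod 5)) = c • 1) ∧
        σ ∉ absGaloisGroupAdjoinRootsOfUnity K 5 := by
  -- an element of determinant `-1`
  obtain ⟨σ₀, hσ₀⟩ := exists_modPCyclotomicCharacterZMod_ne_one (K := K) (p := 5) hK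
  obtain ⟨σ₁, hσ₁⟩ : ∃ σ₁ : absoluteGaloisGroup K, modPCyclotomicCharacterZMod K 5 σ₁ = -1 := by
    rcases units_zmod_five_eq_neg_one_or_sq_eq_neg_one _ hσ₀ with h | h
    · exact ⟨σ₀, h⟩
    · exact ⟨σ₀ ^ 2, by rw [map_pow, h]⟩
  -- `3 ρ̄(σ₁)` has determinant `1`, so it is `ρ̄(τ)` up to a scalar for some `τ ∈ Γ_{K(ζ₅)}`
  set S : Matrix (Fin 2) (Fin 2) (ZMod 5) :=
    ((ρ σ₁ : GL (Fin 2) (ZMod 5)) : Matrix (Fin 2) (Fin 2) (ZMod 5)) with hS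
  have hdetS : S.det = -1 := by
    rw [hS, ← Matrix.GeneralLinearGroup.val_det_apply, hdet σ₁, hσ₁]; rfl
  have hdet3 : ((3 : ZMod 5) • S).det = 1 := by
    rw [Matrix.det_smul, Fintype.card_fin, hdetS]; exact three_sq_mul_neg_one_zmod_five
  obtain ⟨τ, hτ, c, hc⟩ := hPSL _ hdet3
  rw [smul_smul] at hc
  -- `σ = σ₁ τ⁻¹` acts as the scalar `(3c)⁻¹` and has `χ̄₅(σ) = -1`
  refine ⟨σ₁ * τ⁻¹, ⟨(c * 3)⁻¹, ?_⟩, ?_⟩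
  · have hmul : ((ρ (σ₁ * τ⁻¹) : GL (Fin 2) (ZMod 5)) : Matrix (Fin 2) (Fin 2) (ZMod 5)) *
        ((c * 3) • S) = S := by
      rw [← hc, ← Matrix.GeneralLinearGroup.coe_mul, ← map_mul, inv_mul_cancel_right]
    have hSS : S * (((ρ σ₁)⁻¹ : GL (Fin 2) (ZMod 5)) : Matrix (Fin 2) (Fin 2) (ZMod 5)) = 1 := by
      rw [hS, ← Matrix.GeneralLinearGroup.coe_mul, mul_inv_cancel,
        Matrix.GeneralLinearGroup.coe_one]
    have h1 : (c * 3) • ((ρ (σ₁ * τ⁻¹) : GL (Fin 2) (ZMod 5)) : Matrix (Fin 2) (Fin 2) (ZMod 5)) =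
        1 := by
      have := congrArg (· * (((ρ σ₁)⁻¹ : GL (Fin 2) (ZMod 5)) : Matrix (Fin 2) (Fin 2) (ZMod 5)))
        hmul
      simpa only [Matrix.mul_smul, Matrix.smul_mul, Matrix.mul_assoc, hSS, Matrix.mul_one]
        using this
    have hc0 : c * 3 ≠ 0 := by
      intro h0
      rw [h0, zero_smul] at h1
      exact zero_ne_one (congrFun (congrFun h1 0) 0)
    rw [← h1, smul_smul, inv_mul_cancel₀ hc0, one_smul]
  · intro hmem
    have h1 :=
      (mem_absGaloisGroupAdjoinRootsOfUnity_iff_modPCyclotomicCharacterZMod_eq_one _).1 hmem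
    have h2 :=
      (mem_absGaloisGroupAdjoinRootsOfUnity_iff_modPCyclotomicCharacterZMod_eq_one _).1 hτ
    rw [map_mul, map_inv, h2, hσ₁, inv_one, mul_one] at h1
    exact neg_one_ne_one_units_zmod_five h1

/-- **Caraiani–Newton (2023), Lemma 6.1.4** (p. 88) for the `5`-torsion of an elliptic curve:
*"Let `F` be a CM field with `ζ₅ ∉ F` and let `E/F` be an elliptic curve such that the projective
image of `r̄_{E,5}(G_{F(ζ₅)})` is conjugate to `PSL₂(𝔽₅)`. Then the extension of `F` cut out by the
projective image of `r̄_{E,5}(G_F)` does not contain `ζ₅`."*  For a number field `F` in which every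
fifth root of unity is `1` (the CM hypothesis is not needed), a framing `ρ̄` of `E[5]`
(`WeierstrassCurve.IsTorsionGaloisRep E 5 ρ̄`, at the instance `Fact (Nat.Prime 5)` supplied by
the user, e.g. `⟨Nat.prime_five⟩`) whose values on `Γ_{F(ζ₅)}`
(`absGaloisGroupAdjoinRootsOfUnity F 5`) exhaust `SL₂(𝔽₅)` up to scalars (`hPSL`, the printed
hypothesis, see `CaraianiNewton2023_lemma614_of_det`): some `σ ∈ Γ_F` on which `ρ̄` is scalar —
i.e. `σ` in the kernel of the projective representation — does not fix `ζ₅`, so the field cut out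
by the projective image of `ρ̄` does not contain `ζ₅`.  From `CaraianiNewton2023_lemma614_of_det`
and the Weil pairing `det ρ̄_{E,5} = χ̄₅`
(`WeierstrassCurve.det_eq_modPCyclotomicCharacter_of_isTorsionGaloisRep_holds`).  This discharges
hypothesis (4) of Thm. 5.2 in the proof of Thm. 6.1 (p. 90); the remaining ingredients of that
proof (Props. 6.1.5 / 6.1.6, Lemmas 6.1.3 / 6.1.7, Thm. 5.2, solvable descent) have no carrier.
[cite: CaraianiNewton2023, Lemma 6.1.4 p. 88; proof of Thm. 6.1 p. 90] -/
theorem CaraianiNewton2023_lemma614 {F : Type*} [Field F] [NumberField F] [Fact (Nat.Prime 5)]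
    (hF : ∀ x : F, x ^ 5 = 1 → x = 1) (E : WeierstrassCurve F) [E.IsElliptic]
    (ρ : ModPGaloisRep F (ZMod 5) 2) (hρ : E.IsTorsionGaloisRep 5 ρ)
    (hPSL : ∀ M : Matrix (Fin 2) (Fin 2) (ZMod 5), M.det = 1 →
      ∃ τ ∈ absGaloisGroupAdjoinRootsOfUnity F 5, ∃ c : ZMod 5,
        ((ρ τ : GL (Fin 2) (ZMod 5)) : Matrix (Fin 2) (Fin 2) (ZMod 5)) = c • M) :
    ∃ σ : absoluteGaloisGroup F,
      (∃ c : ZMod 5, ((ρ σ : GL (Fin 2) (ZMod 5)) : Matrix (Fin 2) (Fin 2) (ZMod 5)) = c • 1) ∧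
        σ ∉ absGaloisGroupAdjoinRootsOfUnity F 5 :=
  CaraianiNewton2023_lemma614_of_det hF (ρ : absoluteGaloisGroup F →* GL (Fin 2) (ZMod 5))
    (E.det_eq_modPCyclotomicCharacter_of_isTorsionGaloisRep_holds 5 ρ hρ) hPSL

end Literature.NumberTheory.Automorphic
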